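import Mathlib
import Summits.Ventures.PercRepro2.HCov
import Summits.Ventures.PercRepro2.BHKOutside
import Summits.Ventures.PercRepro2.FirstOrderTerms

/-!
# The `T`-world is dominated by the `a₃`-avoidance world, and the `o`-slope of the pendant-root
form at the closed pin is non-negative (blind cell PercRepro2, p5 g22; `proofs/P5-OEDGE.md` §28)

For an instance `(o, a₁, a₂, a₃, b)` let `T = {a₁ ↮ a₂, a₃ ∈ C₂}` (`TEvent`), `D₀ = P(a₃ ∉ C₁)`,
`D_o⁰ = P(a₃ ∉ C₁, o ∈ C₁)` (the world-0 scalars of `FirstOrderTerms`).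

* **`T_clusterIn_mul_D0_le`**: for every up-set `𝓥` of `C₁`, `P(T, C₁ ∈ 𝓥) · D₀ ≤ P(T) · P(C₁ ∈ 𝓥, a₃ ∉ C₁)`
  — BHK06 Thm 1.4 (`bhk_cross_cluster_avoid`) with `s = a₃`, `t = a₁`, `X = {a₁}`, `𝓤 = {a₂ ∈ ·}`:
  on `{a₁ ∉ C(a₃)}` the increasing event `a₂ ∈ C(a₃)` (= `T`) and `C₁ ∈ 𝓥` are negatively correlated.
  Specialisations `T_oL_mul_D0_le` (`P(o ∈ C₁ | T) ≤ γ₀ = D_o⁰/D₀`) and `T_bL_mul_D0_le`.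
* **`slopeS0_nonneg`**: `0 ≤ slopeS0 := D₀·(P(Q∖T, o ∈ C₂) − P(T, o ∈ C₁)) + P(T)·D_o⁰`, the cleared
  `s`-derivative `D₀·∂_sΨ(γ₀)` of the bilinear pendant-root form `Ψ(s, g)` at the closed centering `γ₀`
  (P5-OEDGE §27 addendum 2 listed `P(o ∈ C₁ | T) ≤ γ₀` as a candidate; it is a theorem).
-/

namespace Summit.Ventures.PercRepro2

open UnionCluster

namespace CovForm

namespace FirstOrder

section Sets

variable {V : Type*} {E : Type*} [DecidableEq V]

omit [DecidableEq V] in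
/-- `T ∩ {C₁ ∈ 𝓥} = {a₂ ∈ C(a₃)} ∩ {C₁ ∈ 𝓥} ∩ {a₃ ↮ a₁}`. -/
lemma TEvent_inter_clusterIn_eq (ends : E → Sym2 V) (a₁ a₂ a₃ : V) (𝓥 : Set (Set V)) :
    TEvent ends a₁ a₂ a₃ ∩ clusterInEvent ends a₁ 𝓥 =
      clusterInEvent ends a₃ {W | a₂ ∈ W} ∩ clusterInEvent ends a₁ 𝓥 ∩ avoidAll ends a₃ {a₁} := by
  ext ω
  simp only [TEvent, Set.mem_inter_iff, Set.mem_compl_iff, mem_connEvent, mem_clusterInEvent,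
    Set.mem_setOf_eq, mem_cluster, mem_avoidAll, Finset.mem_singleton, forall_eq]
  constructor
  · rintro ⟨⟨h21, h23⟩, hV⟩
    exact ⟨⟨conn_symm h23, hV⟩, fun h31 => h21 (conn_trans h23 h31)⟩
  · rintro ⟨⟨h32, hV⟩, h31⟩
    exact ⟨⟨fun h21 => h31 (conn_trans h32 h21), conn_symm h32⟩, hV⟩

omit [DecidableEq V] in
/-- `T = {a₂ ∈ C(a₃)} ∩ {a₃ ↮ a₁}`. -/
lemma TEvent_eq_clusterIn_inter_avoid (ends : E → Sym2 V) (a₁ a₂ a₃ : V) :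
    TEvent ends a₁ a₂ a₃ = clusterInEvent ends a₃ {W | a₂ ∈ W} ∩ avoidAll ends a₃ {a₁} := by
  ext ω
  simp only [TEvent, Set.mem_inter_iff, Set.mem_compl_iff, mem_connEvent, mem_clusterInEvent,
    Set.mem_setOf_eq, mem_cluster, mem_avoidAll, Finset.mem_singleton, forall_eq]
  constructor
  · rintro ⟨h21, h23⟩
    exact ⟨conn_symm h23, fun h31 => h21 (conn_trans h23 h31)⟩
  · rintro ⟨h32, h31⟩
    exact ⟨fun h21 => h31 (conn_trans h32 h21), conn_symm h32⟩

end Sets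

section Main

variable {V : Type*} {E : Type*} [Fintype E] [DecidableEq E] [Fintype V] [DecidableEq V]
  {R : Type*} [Field R] [LinearOrder R] [IsStrictOrderedRing R]

/-- **The `T`-world is dominated by the `a₃`-avoidance world**: for every up-set `𝓥` of `C₁`,
`P(T, C₁ ∈ 𝓥) · P(a₃ ∉ C₁) ≤ P(T) · P(C₁ ∈ 𝓥, a₃ ∉ C₁)` (BHK06 Thm 1.4, `bhk_cross_cluster_avoid`,
`s = a₃`, `t = a₁`, `X = {a₁}`, `𝓤 = {a₂ ∈ ·}`). -/
theorem T_clusterIn_mul_D0_le (p : E → R) (hp : IsProbVec p) (ends : E → Sym2 V) (a₁ a₂ a₃ : V)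
    {𝓥 : Set (Set V)} (h𝓥 : IsUpperSet 𝓥) :
    prob p (TEvent ends a₁ a₂ a₃ ∩ clusterInEvent ends a₁ 𝓥) * D0 p ends a₁ a₃ ≤
      prob p (TEvent ends a₁ a₂ a₃) * prob p (clusterInEvent ends a₁ 𝓥 ∩ avoidAll ends a₁ {a₃}) := by
  have h := bhk_cross_cluster_avoid p hp ends a₃ a₁ (Finset.mem_singleton_self a₁)
    (isUpperSet_mem_setOf a₂) h𝓥
  rw [TEvent_inter_clusterIn_eq, TEvent_eq_clusterIn_inter_avoid, D0,
    avoidAll_singleton_comm ends a₁ a₃]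
  exact h

/-- `P(T, o ∈ C₁) · D₀ ≤ P(T) · D_o⁰`, i.e. `P(o ∈ C₁ | T) ≤ γ₀`. -/
theorem T_oL_mul_D0_le (p : E → R) (hp : IsProbVec p) (ends : E → Sym2 V) (o a₁ a₂ a₃ : V) :
    prob p (TEvent ends a₁ a₂ a₃ ∩ connEvent ends a₁ o) * D0 p ends a₁ a₃ ≤
      prob p (TEvent ends a₁ a₂ a₃) * Do0 p ends o a₁ a₃ := by
  have h := T_clusterIn_mul_D0_le p hp ends a₁ a₂ a₃ (isUpperSet_mem_setOf o)
  rw [← connEvent_eq_clusterInEvent ends a₁ o, Set.inter_comm (connEvent ends a₁ o)] at h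
  exact h

/-- `P(T, b ∈ C₁) · D₀ ≤ P(T) · P(b ∈ C₁, a₃ ∉ C₁)`, i.e. `P(b ∈ C₁ | T) ≤ P(b ∈ C₁ | a₃ ∉ C₁)`. -/
theorem T_bL_mul_D0_le (p : E → R) (hp : IsProbVec p) (ends : E → Sym2 V) (a₁ a₂ a₃ b : V) :
    prob p (TEvent ends a₁ a₂ a₃ ∩ connEvent ends a₁ b) * D0 p ends a₁ a₃ ≤
      prob p (TEvent ends a₁ a₂ a₃) * prob p (avoidAll ends a₁ {a₃} ∩ connEvent ends a₁ b) := by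
  have h := T_clusterIn_mul_D0_le p hp ends a₁ a₂ a₃ (isUpperSet_mem_setOf b)
  rw [← connEvent_eq_clusterInEvent ends a₁ b, Set.inter_comm (connEvent ends a₁ b)] at h
  exact h

/-- **The cleared `o`-slope of the pendant-root form at the closed centering**:
`slopeS0 = D₀·(P(Q∖T, o ∈ C₂) − P(T, o ∈ C₁)) + P(T)·D_o⁰` (`= D₀·∂_sΨ(γ₀)` with
`∂_sΨ(g) = P(Q∖T, o ∈ C₂) − P(T, o ∈ C₁) + P(T)·g`, P5-OEDGE §27 addendum 2). -/
noncomputable def slopeS0 (p : E → R) (ends : E → Sym2 V) (o a₁ a₂ a₃ : V) : R :=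
  D0 p ends a₁ a₃ *
      (prob p (avoidAll ends a₂ {a₁} ∩ (connEvent ends a₂ a₃)ᶜ ∩ connEvent ends a₂ o) -
        prob p (TEvent ends a₁ a₂ a₃ ∩ connEvent ends a₁ o)) +
    prob p (TEvent ends a₁ a₂ a₃) * Do0 p ends o a₁ a₃

/-- **`0 ≤ slopeS0`**: the `o`-slope `∂_sΨ(γ₀)` is non-negative — the loss term
`−Q·D₀·(β − σ̄_b)·∂_sΨ(γ₀)` of the derivative form of `B2` is indeed a loss, and the candidate
`P(o ∈ C₁ | T) ≤ γ₀` of P5-OEDGE §27 addendum 2 is a theorem. -/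
theorem slopeS0_nonneg (p : E → R) (hp : IsProbVec p) (ends : E → Sym2 V) (o a₁ a₂ a₃ : V) :
    0 ≤ slopeS0 p ends o a₁ a₂ a₃ := by
  unfold slopeS0
  have h := T_oL_mul_D0_le p hp ends o a₁ a₂ a₃
  have hD0 : 0 ≤ D0 p ends a₁ a₃ := prob_nonneg hp _
  have hQ : 0 ≤ prob p (avoidAll ends a₂ {a₁} ∩ (connEvent ends a₂ a₃)ᶜ ∩ connEvent ends a₂ o) :=
    prob_nonneg hp _
  nlinarith [mul_nonneg hD0 hQ]

end Main

end FirstOrder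

end CovForm

end Summit.Ventures.PercRepro2
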